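import Summits.NavierStokesRegularity.FluidComputer.ClayBlowupLocalZoomResidual
import Literature.Analysis.FluidPDE.AncientMildCompactnessForcedAsymptDivFree
import HarnessLib

/-!
# THE LOCAL ZOOM WITH FORCE, UNIFORM EXPORT

Cell `ns-blowup`, seat `ns-blowup-ecbridge-2` (g11). LABEL: E–C typing (KERNEL — no named fact).
WHAT THIS IS NOT: not Navier–Stokes evidence — a necessary STRUCTURE at each singular point of the
TYPE `ClayBlowup 1`; no inhabitant is claimed. `ClayBlowup.exists_local_zoom_limit` keeps only the
POINTWISE convergence of the zooms; passing a symmetry with MOVING centres to the limit (KNSS 2009,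
proof of Thm 6.2) needs the LOCALLY UNIFORM convergence of the engine and the local bound `4 M_k` on
the approximants. `ClayBlowup.exists_local_zoom_limit_uniform` re-runs the same assembly and exports
them. [cite: KochNadirashviliSereginSverak2009, §6 (6.2)–(6.3), Lemma 6.1, Prop 6.1, Thm 6.2]
-/

noncomputable section

namespace Summit.NavierStokesRegularity.FluidComputer

open Set MeasureTheory Filter Topology Function Metric Real
open scoped ENNReal NNReal RealInnerProductSpace
open Literature.Analysis Literature.Analysis.FluidPDE
open Summit.NavierStokesRegularity.NavierStokesRegularity

namespace ClayBlowup

set_option maxHeartbeats 800000 in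
-- one long bookkeeping proof: the engine's seven hypotheses, the vertex, the uniform exports
/-- **THE LOCAL ZOOM WITH FORCE AT A SINGULAR POINT, UNIFORM EXPORT** (`ν = 1`; no named fact):
as `exists_local_zoom_limit`, PLUS radii `ρ_k` (`ρ_k M_k ≥ (k+1)/2`, `‖u‖ ≤ 4 M_k` on
`[t_b, τ_k] × B(y_k, ρ_k)`) and convergence of the zooms to `W` UNIFORMLY on the boxes
`[−(n+2), −1/(n+2)] × B̄(0, n+2)`, LOCALLY UNIFORMLY on every slice `s < 0`, and pointwise.
[cite: KochNadirashviliSereginSverak2009, Prop 6.1, Lemma 6.1 and proof of Thm 6.2 (arXiv pp. 11–13)] -/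
theorem exists_local_zoom_limit_uniform (X : ClayBlowup 1) {x₁ : EuclideanSpace ℝ (Fin 3)}
    (hx₁ : ¬ IsBackwardBoundedAt X.u X.T x₁) {r' t_b : ℝ} (hr' : 0 < r') (hr'1 : r' ≤ 1)
    (ht_b : t_b ∈ Ico 0 X.T) :
    ∃ (τ : ℕ → ℝ) (y : ℕ → EuclideanSpace ℝ (Fin 3)) (φ : ℕ → ℕ)
      (W : ℝ → EuclideanSpace ℝ (Fin 3) → EuclideanSpace ℝ (Fin 3)),
      StrictMono φ ∧ (∀ k, τ k ∈ Ico t_b X.T) ∧ (∀ k, y k ∈ ball x₁ r') ∧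
      (∀ k : ℕ, (k : ℝ) + 1 ≤ ‖X.u (τ k) (y k)‖) ∧
      (∃ ρ : ℕ → ℝ, (∀ k, 0 < ρ k) ∧ (∀ k : ℕ, ((k : ℝ) + 1) / 2 ≤ ρ k * ‖X.u (τ k) (y k)‖) ∧
        ∀ k, ∀ s ∈ Icc t_b (τ k), ∀ z ∈ ball (y k) (ρ k), ‖X.u s z‖ ≤ 4 * ‖X.u (τ k) (y k)‖) ∧
      ContinuousOn (uncurry W) (Iio 0 ×ˢ univ) ∧ (∀ s < 0, IsWeaklyDivFree (W s)) ∧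
      (∀ s t : ℝ, s < t → t < 0 → ∀ z,
        W t z = UnboundedOperators.heatExtension (W s) (t - s) z - oseenDuhamel 1 s W W t z) ∧
      (∀ s < 0, ∀ z, ‖W s z‖ ≤ 4) ∧
      (∃ σ₁ : ℝ, 0 < σ₁ ∧ ∀ s ∈ Ioo (-σ₁) 0, (1 / 2 : ℝ) ≤ ‖W s 0‖) ∧
      (∀ n : ℕ, TendstoUniformlyOn (fun j (p : ℝ × EuclideanSpace ℝ (Fin 3)) =>
          ‖X.u (τ (φ j)) (y (φ j))‖⁻¹ • X.u (τ (φ j) + ‖X.u (τ (φ j)) (y (φ j))‖⁻¹ ^ 2 * p.1)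
            (y (φ j) + ‖X.u (τ (φ j)) (y (φ j))‖⁻¹ • p.2)) (uncurry W) atTop
          (Icc (-((n : ℝ) + 2)) (-(1 / ((n : ℝ) + 2))) ×ˢ closedBall 0 ((n : ℝ) + 2))) ∧
      (∀ s < 0, TendstoLocallyUniformly (fun j z => ‖X.u (τ (φ j)) (y (φ j))‖⁻¹ • X.u
          (τ (φ j) + ‖X.u (τ (φ j)) (y (φ j))‖⁻¹ ^ 2 * s) (y (φ j) + ‖X.u (τ (φ j)) (y (φ j))‖⁻¹ • z)) (W s) atTop) ∧
      (∀ s < 0, ∀ z, Tendsto (fun j => ‖X.u (τ (φ j)) (y (φ j))‖⁻¹ • X.u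
          (τ (φ j) + ‖X.u (τ (φ j)) (y (φ j))‖⁻¹ ^ 2 * s) (y (φ j) + ‖X.u (τ (φ j)) (y (φ j))‖⁻¹ • z)) atTop (𝓝 (W s z))) := by
  have hT := X.T_pos
  obtain ⟨τ, y, hdata⟩ := X.exists_local_zoom_data hx₁ hr' ht_b
  have hτ : ∀ k, τ k ∈ Ico t_b X.T := fun k => (hdata k).1
  have hy : ∀ k, y k ∈ ball x₁ r' := fun k => (hdata k).2.1
  have hL : ∀ k : ℕ, (k : ℝ) + 1 ≤ (r' - dist (y k) x₁) ^ 2 * ‖X.u (τ k) (y k)‖ :=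
    fun k => (hdata k).2.2.1
  have h4 : ∀ k, ∀ s ∈ Icc t_b (τ k), ∀ z ∈ ball (y k) ((r' - dist (y k) x₁) / 2),
      ‖X.u s z‖ ≤ 4 * ‖X.u (τ k) (y k)‖ := fun k => (hdata k).2.2.2.2.1
  have hMr : ∀ k : ℕ, ((k : ℝ) + 1) / r' ^ 2 ≤ ‖X.u (τ k) (y k)‖ := fun k => (hdata k).2.2.2.2.2
  set M : ℕ → ℝ := fun k => ‖X.u (τ k) (y k)‖ with hM
  set d : ℕ → ℝ := fun k => r' - dist (y k) x₁ with hd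
  have hk1 : ∀ k : ℕ, (k : ℝ) + 1 ≤ M k := by
    intro k
    refine le_trans ?_ (hMr k)
    rw [le_div_iff₀ (by positivity)]
    have : r' ^ 2 ≤ 1 := pow_le_one₀ hr'.le hr'1
    nlinarith [k.cast_nonneg (α := ℝ)]
  have hM1 : ∀ k, 1 ≤ M k := fun k => le_trans (by linarith [k.cast_nonneg (α := ℝ)]) (hk1 k)
  have hM0 : ∀ k, 0 < M k := fun k => lt_of_lt_of_le one_pos (hM1 k)
  have hd0 : ∀ k, 0 < d k := fun k => sub_pos.2 (mem_ball.1 (hy k))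
  have hd1 : ∀ k, d k ≤ 1 := fun k => by
    have : d k ≤ r' := by simp only [hd]; linarith [dist_nonneg (x := y k) (y := x₁)]
    exact this.trans hr'1
  have hdM : ∀ k : ℕ, (k : ℝ) + 1 ≤ d k * M k := by
    intro k
    have h1 : d k ^ 2 * M k ≤ d k * M k := by
      have : d k ^ 2 ≤ d k := by nlinarith [hd0 k, hd1 k]
      exact mul_le_mul_of_nonneg_right this (hM0 k).le
    exact (hL k).trans h1
  set R : ℕ → ℝ := fun k => d k * M k / 2 with hR
  have hR0 : ∀ k, 0 < R k := fun k => by simp only [hR]; exact div_pos (mul_pos (hd0 k) (hM0 k)) two_pos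
  have hRk : ∀ k : ℕ, ((k : ℝ) + 1) / 2 ≤ R k := fun k => by
    simp only [hR]; linarith [hdM k]
  have hRM : ∀ k, R k / M k = d k / 2 := fun k => by
    simp only [hR]; field_simp [(hM0 k).ne']
  have hΘ : ∀ k : ℕ, 1 / R k + (1 + M k) / R k ^ 4 + (M k)⁻¹ ≤ 35 / ((k : ℝ) + 1) := by
    intro k
    have hk0 : (0 : ℝ) < (k : ℝ) + 1 := by positivity
    have h1 : 1 / R k ≤ 2 / ((k : ℝ) + 1) := by
      rw [div_le_div_iff₀ (hR0 k) hk0]; linarith [hRk k]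
    have h3 : (M k)⁻¹ ≤ 1 / ((k : ℝ) + 1) := by
      rw [inv_eq_one_div, div_le_div_iff₀ (hM0 k) hk0]; linarith [hk1 k]
    have h2 : (1 + M k) / R k ^ 4 ≤ 32 / ((k : ℝ) + 1) := by
      have hR4 : R k ^ 4 = (d k * M k) ^ 4 / 16 := by simp only [hR]; ring
      have hdM3 : (k : ℝ) + 1 ≤ d k ^ 4 * M k ^ 3 := by
        have h5 : ((k : ℝ) + 1) ^ 2 ≤ (d k ^ 2 * M k) ^ 2 :=
          pow_le_pow_left₀ hk0.le (hL k) 2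
        have h6 : ((k : ℝ) + 1) ^ 2 * 1 ≤ (d k ^ 2 * M k) ^ 2 * M k :=
          mul_le_mul h5 (hM1 k) zero_le_one (by positivity)
        have h7 : (k : ℝ) + 1 ≤ ((k : ℝ) + 1) ^ 2 * 1 := by nlinarith
        calc (k : ℝ) + 1 ≤ ((k : ℝ) + 1) ^ 2 * 1 := h7
          _ ≤ (d k ^ 2 * M k) ^ 2 * M k := h6
          _ = d k ^ 4 * M k ^ 3 := by ring
      rw [hR4, div_le_div_iff₀ (by have := mul_pos (hd0 k) (hM0 k); positivity) hk0]
      have h8 : (1 + M k) * ((k : ℝ) + 1) ≤ 2 * M k * (d k ^ 4 * M k ^ 3) := by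
        have : (1 + M k) ≤ 2 * M k := by linarith [hM1 k]
        exact mul_le_mul this hdM3 hk0.le (by positivity)
      calc (1 + M k) * ((k : ℝ) + 1) ≤ 2 * M k * (d k ^ 4 * M k ^ 3) := h8
        _ = 32 * ((d k * M k) ^ 4 / 16) := by ring
    calc 1 / R k + (1 + M k) / R k ^ 4 + (M k)⁻¹
        ≤ 2 / ((k : ℝ) + 1) + 32 / ((k : ℝ) + 1) + 1 / ((k : ℝ) + 1) := add_le_add (add_le_add h1 h2) h3
      _ = 35 / ((k : ℝ) + 1) := by ring
  have hΘ35 : ∀ k : ℕ, 1 / R k + (1 + M k) / R k ^ 4 + (M k)⁻¹ ≤ 35 := fun k =>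
    (hΘ k).trans (div_le_self (by norm_num) (by linarith [k.cast_nonneg (α := ℝ)]))
  have hΘ0 : ∀ k : ℕ, 0 ≤ 1 / R k + (1 + M k) / R k ^ 4 + (M k)⁻¹ := fun k => by
    have := hR0 k; have := hM0 k; positivity
  have hΘlim : Tendsto (fun k : ℕ => 1 / R k + (1 + M k) / R k ^ 4 + (M k)⁻¹) atTop (𝓝 0) := by
    refine squeeze_zero (fun k => hΘ0 k) hΘ ?_
    have h := (tendsto_one_div_add_atTop_nhds_zero_nat (𝕜 := ℝ)).const_mul 35
    rw [mul_zero] at h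
    refine h.congr fun k => ?_
    ring
  set A : ℕ → ℝ := fun k => -(τ k - t_b) * M k ^ 2 with hA
  have hAlim : Tendsto A atTop atBot := by
    obtain ⟨B₀, hB₀⟩ := X.exists_norm_le one_pos (show (t_b + X.T) / 2 < X.T by linarith [ht_b.2])
    have hev : ∀ᶠ k : ℕ in atTop, A k ≤ -((X.T - t_b) / 2) * ((k : ℝ) + 1) := by
      refine (eventually_gt_atTop ⌈B₀⌉₊).mono fun k hk => ?_
      have hMB : B₀ < M k := by
        have h1 : (⌈B₀⌉₊ : ℝ) < k := by exact_mod_cast hk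
        linarith [Nat.le_ceil B₀, hk1 k]
      have hτk : (t_b + X.T) / 2 < τ k := by
        by_contra h
        push Not at h
        exact absurd (hB₀ (τ k) ⟨ht_b.1.trans (hτ k).1, h⟩ (y k)) (not_le.2 hMB)
      have h2 : (X.T - t_b) / 2 ≤ τ k - t_b := by linarith
      have h3 : (k : ℝ) + 1 ≤ M k ^ 2 := by nlinarith [hk1 k, hM1 k]
      simp only [hA]
      nlinarith [h2, h3, sub_pos.2 ht_b.2]
    refine tendsto_atBot_mono' atTop hev ?_
    have h1 : Tendsto (fun k : ℕ => (k : ℝ) + 1) atTop atTop :=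
      tendsto_atTop_add_const_right _ _ tendsto_natCast_atTop_atTop
    exact h1.const_mul_atTop_of_neg (by linarith [ht_b.2])
  have hcut := fun k => exists_lipschitz_cutoff (E := EuclideanSpace ℝ (Fin 3)) (hR0 k)
  choose χ hχ01 hχ1 hχ0 hχL hχc using hcut
  set w : ℕ → ℝ → EuclideanSpace ℝ (Fin 3) → EuclideanSpace ℝ (Fin 3) := fun k =>
    (M k)⁻¹ • stPull ((M k)⁻¹ ^ 2) (M k)⁻¹ (τ k) (y k) X.u with hw
  set wt : ℕ → ℝ → EuclideanSpace ℝ (Fin 3) → EuclideanSpace ℝ (Fin 3) := fun k σ z =>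
    χ k z • w k σ z with hwt
  set Gt : ℕ → ℝ → ℝ → EuclideanSpace ℝ (Fin 3) → EuclideanSpace ℝ (Fin 3) := fun k s t z =>
    wt k t z - UnboundedOperators.heatExtension (wt k s) (t - s) z + oseenDuhamel 1 s (wt k) (wt k) t z
    with hGt
  have hw_apply : ∀ k σ z, w k σ z = (M k)⁻¹ • X.u (τ k + (M k)⁻¹ ^ 2 * σ) (y k + (M k)⁻¹ • z) :=
    fun k σ z => rfl
  obtain ⟨P, Q, hP0, hQ0, hres⟩ := X.exists_local_zoom_residual_bounds
  have h4' : ∀ k, ∀ s ∈ Icc t_b (τ k), ∀ z ∈ ball (y k) (R k / M k), ‖X.u s z‖ ≤ 4 * M k := by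
    intro k s hs z hz
    rw [hRM k] at hz
    exact h4 k s hs z hz
  have hresk : ∀ k, ∀ s t : ℝ, A k < s → s < t → t ≤ 0 →
      (t - s ≤ 1 → ∀ z, ‖Gt k s t z‖ ≤
        (P + Q * (1 / R k + 1 / R k ^ 2 + (1 + M k) / R k ^ 4 + (M k)⁻¹)) * Real.sqrt (t - s)) ∧
      (∀ z, ‖z‖ ≤ R k / 4 → ‖Gt k s t z‖ ≤
        Q * (1 / R k + 1 / R k ^ 2 + (1 + M k) / R k ^ 4 + (M k)⁻¹) * (Real.sqrt (t - s) + (t - s))) := by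
    intro k s t hAs hst ht0
    have hAs' : -(τ k - t_b) * M k ^ 2 < s := by simpa only [hA] using hAs
    by_cases htb' : t_b < τ k
    · exact hres (hτ k).2 ht_b.1 htb' (hM1 k) (hR0 k) (h4' k) (hχ01 k) (hχ1 k) (hχ0 k) (hχL k)
        (hχc k) s t hAs' hst ht0
    · exfalso
      have h0 : τ k = t_b := le_antisymm (not_lt.1 htb') (hτ k).1
      rw [h0, sub_self, neg_zero, zero_mul] at hAs'
      linarith
  have hΘ' : ∀ k : ℕ, 1 / R k + 1 / R k ^ 2 + (1 + M k) / R k ^ 4 + (M k)⁻¹ ≤ 39 / ((k : ℝ) + 1) := by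
    intro k
    have hk0 : (0 : ℝ) < (k : ℝ) + 1 := by positivity
    have h1 : 1 / R k ^ 2 ≤ 4 / ((k : ℝ) + 1) := by
      have hR1 : ((k : ℝ) + 1) / 2 ≤ R k := hRk k
      have hsq0 : (((k : ℝ) + 1) / 2) ^ 2 ≤ R k ^ 2 := pow_le_pow_left₀ (by positivity) hR1 2
      have hk1' : (1 : ℝ) ≤ (k : ℝ) + 1 := by linarith [k.cast_nonneg (α := ℝ)]
      have hsq : ((k : ℝ) + 1) / 4 ≤ R k ^ 2 := by nlinarith [hsq0, hk1']
      rw [div_le_div_iff₀ (pow_pos (hR0 k) 2) hk0]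
      nlinarith [hsq, hk0]
    have h2 := hΘ k
    calc 1 / R k + 1 / R k ^ 2 + (1 + M k) / R k ^ 4 + (M k)⁻¹
        = (1 / R k + (1 + M k) / R k ^ 4 + (M k)⁻¹) + 1 / R k ^ 2 := by ring
      _ ≤ 35 / ((k : ℝ) + 1) + 4 / ((k : ℝ) + 1) := add_le_add h2 h1
      _ = 39 / ((k : ℝ) + 1) := by ring
  have hΘ'39 : ∀ k : ℕ, 1 / R k + 1 / R k ^ 2 + (1 + M k) / R k ^ 4 + (M k)⁻¹ ≤ 39 := fun k =>
    (hΘ' k).trans (div_le_self (by norm_num) (by linarith [k.cast_nonneg (α := ℝ)]))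
  have hΘ'0 : ∀ k : ℕ, 0 ≤ 1 / R k + 1 / R k ^ 2 + (1 + M k) / R k ^ 4 + (M k)⁻¹ := fun k => by
    have := hR0 k; have := hM0 k; positivity
  have hΘ'lim : Tendsto (fun k : ℕ => 1 / R k + 1 / R k ^ 2 + (1 + M k) / R k ^ 4 + (M k)⁻¹) atTop (𝓝 0) := by
    refine squeeze_zero (fun k => hΘ'0 k) hΘ' ?_
    have h := (tendsto_one_div_add_atTop_nhds_zero_nat (𝕜 := ℝ)).const_mul 39
    rw [mul_zero] at h
    refine h.congr fun k => ?_
    ring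
  have hphys : ∀ k σ, A k < σ → σ ≤ 0 → τ k + (M k)⁻¹ ^ 2 * σ ∈ Icc t_b (τ k) := by
    intro k σ hσ hσ0
    have hc0 : 0 < (M k)⁻¹ := inv_pos.2 (hM0 k)
    have hc2 : (M k)⁻¹ ^ 2 * M k ^ 2 = 1 := by
      rw [← mul_pow, inv_mul_cancel₀ (hM0 k).ne', one_pow]
    constructor
    · have h1 : (M k)⁻¹ ^ 2 * (-(τ k - t_b) * M k ^ 2) < (M k)⁻¹ ^ 2 * σ :=
        mul_lt_mul_of_pos_left (by simpa only [hA] using hσ) (pow_pos hc0 2)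
      have h2 : (M k)⁻¹ ^ 2 * (-(τ k - t_b) * M k ^ 2) = -(τ k - t_b) := by
        rw [show (M k)⁻¹ ^ 2 * (-(τ k - t_b) * M k ^ 2) = -(τ k - t_b) * ((M k)⁻¹ ^ 2 * M k ^ 2) by
          ring, hc2, mul_one]
      linarith
    · nlinarith [pow_pos hc0 2]
  have hcl : ∀ k, ∃ (g : ℝ → EuclideanSpace ℝ (Fin 3) → EuclideanSpace ℝ (Fin 3))
      (q : ℝ → EuclideanSpace ℝ (Fin 3) → ℝ), IsClassicalNSSolutionOn (Ioc (A k) 0) 1 g (w k) q := by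
    intro k
    have h := X.classical.nsRescale_translate (inv_pos.2 (hM0 k)) (τ k) (y k)
    refine ⟨_, _, h.mono (fun σ hσ => ?_) (uniqueDiffOn_Ioc _ _)⟩
    have h1 := hphys k σ hσ.1 hσ.2
    exact ⟨ht_b.1.trans h1.1, h1.2.trans_lt (hτ k).2⟩
  have hwslice : ∀ k, ∀ σ ∈ Ioc (A k) 0, Continuous (w k σ) := fun k σ hσ => by
    obtain ⟨g, q, h⟩ := hcl k; exact (h.contDiff_velocity hσ).continuous
  have hwdiv : ∀ k, ∀ σ ∈ Ioc (A k) 0, IsWeaklyDivFree (w k σ) := fun k σ hσ => by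
    obtain ⟨g, q, h⟩ := hcl k
    exact VectorCalculus.IsDivFree.isWeaklyDivFree_holds (h.divFree σ hσ)
      (contDiff_infty.1 (h.contDiff_velocity hσ) 1)
  have hwtslice : ∀ k, ∀ σ ∈ Ioc (A k) 0, Continuous (wt k σ) := fun k σ hσ =>
    (hχc k).smul (hwslice k σ hσ)
  have hcont : ∀ k, ContinuousOn (uncurry (wt k)) (Ioo (A k) 0 ×ˢ univ) := by
    intro k
    obtain ⟨g, q, h⟩ := hcl k
    have h1 : ContinuousOn (uncurry (w k)) (Ioo (A k) 0 ×ˢ univ) :=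
      h.smooth_velocity.continuousOn.mono (Set.prod_mono Ioo_subset_Ioc_self subset_rfl)
    have h0 : uncurry (wt k) = fun p : ℝ × EuclideanSpace ℝ (Fin 3) => χ k p.2 • uncurry (w k) p := by
      funext p; rfl
    rw [h0]
    exact ((hχc k).comp continuous_snd).continuousOn.smul h1
  have hw4 : ∀ k σ, A k < σ → σ ≤ 0 → ∀ z, ‖z‖ < R k → ‖w k σ z‖ ≤ 4 := by
    intro k σ hσ hσ0 z hz
    have hc0 : 0 < (M k)⁻¹ := inv_pos.2 (hM0 k)
    rw [hw_apply, norm_smul, Real.norm_of_nonneg hc0.le]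
    have hball : y k + (M k)⁻¹ • z ∈ ball (y k) (R k / M k) := by
      rw [mem_ball, dist_eq_norm, add_sub_cancel_left, norm_smul, Real.norm_of_nonneg hc0.le,
        div_eq_inv_mul]
      exact mul_lt_mul_of_pos_left hz hc0
    have h := h4' k _ (hphys k σ hσ hσ0) _ hball
    calc (M k)⁻¹ * ‖X.u (τ k + (M k)⁻¹ ^ 2 * σ) (y k + (M k)⁻¹ • z)‖ ≤ (M k)⁻¹ * (4 * M k) :=
          mul_le_mul_of_nonneg_left h hc0.le
      _ = 4 * (M k * (M k)⁻¹) := by ring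
      _ = 4 := by rw [mul_inv_cancel₀ (hM0 k).ne', mul_one]
  have hwt4 : ∀ k σ, A k < σ → σ ≤ 0 → ∀ z, ‖wt k σ z‖ ≤ 4 := by
    intro k σ hσ hσ0 z
    show ‖χ k z • w k σ z‖ ≤ 4
    rw [norm_smul, Real.norm_of_nonneg (hχ01 k z).1]
    by_cases hz : χ k z = 0
    · rw [hz, zero_mul]; norm_num
    · have hzR : ‖z‖ < R k := by
        have : ¬ 3 * R k / 4 ≤ ‖z‖ := fun h' => hz (hχ0 k z h')
        push Not at this; linarith [hR0 k]
      calc χ k z * ‖w k σ z‖ ≤ 1 * 4 :=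
            mul_le_mul (hχ01 k z).2 (hw4 k σ hσ hσ0 z hzR) (norm_nonneg _) zero_le_one
        _ = 4 := one_mul _
  have hbdd : ∀ k, ∀ σ ∈ Ioo (A k) 0, ∀ z, ‖wt k σ z‖ ≤ 4 := fun k σ hσ z =>
    hwt4 k σ hσ.1 hσ.2.le z
  set γ : ℝ := P + Q * 39 with hγ
  have hγ0 : 0 ≤ γ := by rw [hγ]; positivity
  have hmild : ∀ k, ∀ s t : ℝ, A k < s → s < t → t < 0 → ∀ z,
      wt k t z = UnboundedOperators.heatExtension (wt k s) (t - s) z -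
        oseenDuhamel 1 s (wt k) (wt k) t z + Gt k s t z := by
    intro k s t _ _ _ z; simp only [hGt]; abel
  have hGb0 : ∀ k, ∀ s t : ℝ, A k < s → s < t → t ≤ 0 → t - s ≤ 1 → ∀ z,
      ‖Gt k s t z‖ ≤ γ * Real.sqrt (t - s) := by
    intro k s t hAs hst ht0 hlag z
    refine ((hresk k s t hAs hst ht0).1 hlag z).trans (mul_le_mul_of_nonneg_right ?_ (Real.sqrt_nonneg _))
    rw [hγ]
    exact add_le_add le_rfl (mul_le_mul_of_nonneg_left (hΘ'39 k) hQ0)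
  have hGb : ∀ k, ∀ s t : ℝ, A k < s → s < t → t < 0 → t - s ≤ 1 → ∀ z,
      ‖Gt k s t z‖ ≤ γ * Real.sqrt (t - s) := fun k s t hAs hst ht0 hlag z =>
    hGb0 k s t hAs hst ht0.le hlag z
  have hRlim : Tendsto R atTop atTop := by
    refine tendsto_atTop_mono hRk ?_
    exact (tendsto_atTop_add_const_right _ _ tendsto_natCast_atTop_atTop).atTop_div_const two_pos
  have hGlim' : ∀ s t : ℝ, s < t → t ≤ 0 → ∀ z, Tendsto (fun k => Gt k s t z) atTop (𝓝 0) := by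
    intro s t hst ht0 z
    have hev : ∀ᶠ k in atTop, ‖Gt k s t z‖ ≤
        Q * (1 / R k + 1 / R k ^ 2 + (1 + M k) / R k ^ 4 + (M k)⁻¹) * (Real.sqrt (t - s) + (t - s)) := by
      filter_upwards [hAlim.eventually (eventually_lt_atBot s),
        hRlim.eventually (eventually_ge_atTop (4 * ‖z‖))] with k hk hkR
      exact (hresk k s t hk hst ht0).2 z (by linarith)
    refine squeeze_zero_norm' hev ?_
    have h := (hΘ'lim.const_mul Q).mul_const (Real.sqrt (t - s) + (t - s))
    rw [mul_zero, zero_mul] at h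
    exact h
  have hGlim : ∀ s t : ℝ, s < t → t < 0 → ∀ z, Tendsto (fun k => Gt k s t z) atTop (𝓝 0) :=
    fun s t hst ht0 z => hGlim' s t hst ht0.le z
  have hdivlim : ∀ t < 0, ∀ θ : EuclideanSpace ℝ (Fin 3) → ℝ,
      FunctionSpaces.IsTestFunctionOn (⊤ : TopologicalSpace.Opens (EuclideanSpace ℝ (Fin 3))) θ →
      Tendsto (fun k => ∫ x, ⟪wt k t x, gradient θ x⟫) atTop (𝓝 0) := by
    intro t ht θ hθ
    obtain ⟨Rθ, hRθ⟩ := hθ.hasCompactSupport.isCompact.isBounded.subset_closedBall (0 : EuclideanSpace ℝ (Fin 3))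
    have hev : ∀ᶠ k in atTop, ∫ x, ⟪wt k t x, gradient θ x⟫ = 0 := by
      filter_upwards [hAlim.eventually (eventually_lt_atBot t),
        hRlim.eventually (eventually_ge_atTop (2 * Rθ))] with k hk hkR
      have heq : (fun x => ⟪wt k t x, gradient θ x⟫) = fun x => ⟪w k t x, gradient θ x⟫ := by
        funext x
        by_cases hx : x ∈ tsupport θ
        · have hxR : ‖x‖ ≤ R k / 2 := by
            have := hRθ hx; rw [mem_closedBall, dist_zero_right] at this; linarith
          show ⟪χ k x • w k t x, gradient θ x⟫ = ⟪w k t x, gradient θ x⟫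
          rw [hχ1 k x hxR, one_smul]
        · have hg : gradient θ x = 0 := by
            have hx' : x ∉ tsupport (fderiv ℝ θ) := fun h => hx (tsupport_fderiv_subset ℝ h)
            have h0 : fderiv ℝ θ x = 0 := image_eq_zero_of_notMem_tsupport hx'
            rw [gradient, h0, map_zero]
          rw [hg, inner_zero_right, inner_zero_right]
      rw [heq]
      exact hwdiv k t ⟨hk, ht.le⟩ θ hθ
    exact tendsto_const_nhds.congr' (hev.mono fun k hk => hk.symm)
  obtain ⟨φ, W, hφ, hWc, hWdiv, hWbd, hWmild, hWU, hWpt, hWlu⟩ :=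
    exists_oseenMild_limit_of_forced_asymptDivFree_const hγ0 hAlim hcont hdivlim hmild hGb hGlim hbdd
  obtain ⟨K₀, hK₀, hHold⟩ := exists_holder_quarter_of_oseenMild_perturbed (E := EuclideanSpace ℝ (Fin 3))
  set L : ℝ := K₀ * (4 + 4 ^ 2 + γ) with hL
  have hL0 : 0 < L := by rw [hL]; positivity
  obtain ⟨σ₁, hσ₁0, hσ₁1, hσ₁L⟩ : ∃ σ₁ : ℝ, 0 < σ₁ ∧ σ₁ ≤ 1 ∧ L * σ₁ ^ (1 / 4 : ℝ) ≤ 1 / 2 := by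
    refine ⟨min 1 ((1 / (2 * L)) ^ (4 : ℝ)), lt_min one_pos (by positivity), min_le_left _ _, ?_⟩
    have h1 : (min 1 ((1 / (2 * L)) ^ (4 : ℝ))) ^ (1 / 4 : ℝ) ≤ ((1 / (2 * L)) ^ (4 : ℝ)) ^ (1 / 4 : ℝ) :=
      Real.rpow_le_rpow (le_min zero_le_one (by positivity)) (min_le_right _ _) (by norm_num)
    have h2 : ((1 / (2 * L)) ^ (4 : ℝ)) ^ (1 / 4 : ℝ) = 1 / (2 * L) := by
      rw [← Real.rpow_mul (by positivity)]; norm_num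
    rw [h2] at h1
    calc L * (min 1 ((1 / (2 * L)) ^ (4 : ℝ))) ^ (1 / 4 : ℝ) ≤ L * (1 / (2 * L)) :=
          mul_le_mul_of_nonneg_left h1 hL0.le
      _ = 1 / 2 := by field_simp
  have hvertex : ∀ k, A k < -3 → ∀ σ ∈ Icc (-σ₁) 0, (1 / 2 : ℝ) ≤ ‖wt k σ 0‖ := by
    intro k hk σ hσ
    have hmod := hHold (u := wt k) (G := Gt k) (a := -3) (b := 0) (m := 4) (N := γ)
      (by norm_num) hγ0 (fun t ht => hwtslice k t ⟨by linarith [ht.1], ht.2⟩)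
      (fun t ht z => hwt4 k t (by linarith [ht.1]) ht.2 z)
      (fun s t hs hst htb z => by simp only [hGt]; abel)
      (fun s t hs hst htb hlag z => hGb0 k s t (by linarith) hst htb hlag z)
      0 ⟨by norm_num, le_rfl⟩ σ ⟨by linarith [hσ.1], hσ.2⟩ 0 0
    have h00 : ‖wt k 0 0‖ = 1 := by
      show ‖χ k 0 • w k 0 0‖ = 1
      rw [hχ1 k 0 (by rw [norm_zero]; linarith [hR0 k]), one_smul, hw_apply, mul_zero, add_zero,
        smul_zero, add_zero, norm_smul, Real.norm_of_nonneg (inv_pos.2 (hM0 k)).le]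
      exact inv_mul_cancel₀ (hM0 k).ne'
    have hdist : ‖wt k σ 0 - wt k 0 0‖ ≤ L * σ₁ ^ (1 / 4 : ℝ) := by
      refine hmod.trans ?_
      rw [sub_zero, sub_self, norm_zero, ← hL]
      refine mul_le_mul_of_nonneg_left (Real.rpow_le_rpow (le_max_of_le_right le_rfl) ?_ (by norm_num))
        hL0.le
      refine max_le ?_ hσ₁0.le
      rw [abs_le]; constructor <;> linarith [hσ.1, hσ.2]
    have h1 : ‖wt k 0 0‖ - ‖wt k σ 0‖ ≤ ‖wt k 0 0 - wt k σ 0‖ := norm_sub_norm_le _ _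
    rw [norm_sub_rev] at h1
    linarith [h00, hdist, hσ₁L, h1]
  have hRφ : Tendsto (fun j => R (φ j)) atTop atTop := hRlim.comp hφ.tendsto_atTop
  have hwt_eq : ∀ k σ z, ‖z‖ ≤ R k / 2 → wt k σ z = w k σ z := fun k σ z hz => by
    show χ k z • w k σ z = w k σ z
    rw [hχ1 k z hz, one_smul]
  refine ⟨τ, y, φ, W, hφ, hτ, hy, hk1, ⟨fun k => R k / M k, fun k => div_pos (hR0 k) (hM0 k),
    fun k => ?_, h4'⟩, hWc, hWdiv, hWmild, hWbd, ⟨σ₁, hσ₁0, fun s hs => ?_⟩, fun n => ?_,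
    fun s hs => ?_, fun s hs z => ?_⟩
  · rw [div_mul_cancel₀ _ (hM0 k).ne']; exact hRk k
  · have hAφ : Tendsto (fun j => A (φ j)) atTop atBot := hAlim.comp hφ.tendsto_atTop
    have hev : ∀ᶠ j in atTop, (1 / 2 : ℝ) ≤ ‖wt (φ j) s 0‖ := by
      filter_upwards [hAφ.eventually (eventually_lt_atBot (-3))] with j hj
      exact hvertex (φ j) hj s ⟨hs.1.le, hs.2.le⟩
    exact ge_of_tendsto ((hWpt s hs.2 0).norm) hev
  · rw [Metric.tendstoUniformlyOn_iff] -- eventually `χ_{φ j} = 1` on `B̄(0, n+2)`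
    intro ε hε
    filter_upwards [(Metric.tendstoUniformlyOn_iff.1 (hWU n)) ε hε,
      hRφ.eventually (eventually_ge_atTop (2 * ((n : ℝ) + 2)))] with j hj hR p hp
    have hp2 : ‖p.2‖ ≤ R (φ j) / 2 := by linarith [mem_closedBall_zero_iff.1 hp.2]
    have h := hj p hp
    rwa [show uncurry (wt (φ j)) p = wt (φ j) p.1 p.2 from rfl, hwt_eq (φ j) p.1 p.2 hp2] at h
  · rw [Metric.tendstoLocallyUniformly_iff] -- eventually `χ_{φ j} = 1` near each point
    intro ε hε z₀
    obtain ⟨V, hV, hev⟩ := (Metric.tendstoLocallyUniformly_iff.1 (hWlu s hs)) ε hε z₀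
    refine ⟨V ∩ ball z₀ 1, inter_mem hV (ball_mem_nhds z₀ one_pos), ?_⟩
    filter_upwards [hev, hRφ.eventually (eventually_ge_atTop (2 * (‖z₀‖ + 1)))] with j hj hR z hz
    have h1 : ‖z‖ ≤ ‖z₀‖ + 1 := by
      linarith [mem_ball_iff_norm.1 hz.2, norm_le_norm_add_norm_sub' z z₀, norm_sub_rev z z₀]
    have h := hj z hz.1; rwa [hwt_eq (φ j) s z (by linarith)] at h
  · refine (hWpt s hs z).congr' ?_
    filter_upwards [hRφ.eventually (eventually_ge_atTop (2 * ‖z‖))] with j hj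
    show χ (φ j) z • w (φ j) s z = _
    rw [hχ1 (φ j) z (by linarith), one_smul]
    exact hw_apply _ _ _

end ClayBlowup

end Summit.NavierStokesRegularity.FluidComputer

end
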